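import Summits.BirchSwinnertonDyer.BirchSwinnertonDyer.Theorems.ManinLocalTwoThreeCubeRootDescentClosed
import Summits.BirchSwinnertonDyer.Rank1Residual.ManinAdditive.CuspidalKummerCubeDescentAtN
import HarnessLib

/-!
# LAW₃ ⟸ G1 ∧ G0 at level `N` (cell `bsd-f2-manin`, planner `-an` g36, MEMO-an §79.10, FILE F2; proposed tree path
`Summits/BirchSwinnertonDyer/BirchSwinnertonDyer/Theorems/ManinLocalTwoThreeCubeRootDescentAtN.lean`,
`--supports stmt-BirchSwinnertonDyer-22968`)

Imports FILE F (`…CubeRootDescentClosed`: M0/M1/M2 and N1 PROVED, `LAW₃ ⟸ P79`) and FILE A2 (`…CuspidalKummerCubeDescentAtN`: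
G1 `CubeRepSecondDescent`, G0 `KummerCubeSeriesNotCubeAtN`, node N2ᴺ, `newmanCond_thirdExp`, the composition).  PROVED here:

* `etaLaurent_thirdExp_pow` — `η_{r/3}³ = q^{S₁(r)/24}·g` in `ℂ((q))` at level `N`;
* `noNewmanThirdRootRepAtN_of : M1 → M2 → G0 → N2ᴺ` and `noNewmanThirdRootRepAtN_of_geometric : G0 → N2ᴺ` (M1/M2 by name);
* **`cuspidalKummerCubeExponentLaw_of_levelN : CubeRepSecondDescent → KummerCubeSeriesNotCubeAtN → CuspidalKummerCubeExponentLaw`**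
  (LAW₃ ⟸ G1 ∧ G0, BY NAME), `…NonBlind_of_levelN` (LAW₃♮), `noBlindThreeTorsionOptimal_of_levelN` (NB₃ ⟸ E-an-57 ∧ G1 ∧ G0);
* `kummerCubeSeriesNotCubeAtN_of_atThreeN : KummerCubeSeriesNotCubeAtThreeN → KummerCubeSeriesNotCubeAtN` (G0 ⟸ P79).

So LAW₃ has two closed reductions on record: `⟸ P79` (one leaf at level `3N`) and `⟸ G1 ∧ G0` (two leaves at level `N`:
a cusp-order statement with its own census column, and the bare optimality statement).  Checked as the concatenation
A ++ A2 ++ B ++ F2(§1–2) ++ Literature ++ F ++ F2(§3) (`CubeDescentFullSim3-an-g36.lean`, rc 0, 0 sorry, 2026-08-29).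
PARTITION unchanged · beyond-print theorem: no · BSD is not proved by this. [folklore]
-/

set_option linter.dupNamespace false
set_option autoImplicit false

noncomputable section

open PowerSeries CongruenceSubgroup
open WeierstrassCurve Literature.NumberTheory.EllipticCurves

namespace Summit.BirchSwinnertonDyer.BirchSwinnertonDyer.Theorems.ManinLocalTwoThree.CubeRootDescent

open Summit.BirchSwinnertonDyer.Rank1Residual.ManinAdditive.CuspidalKummer
open Summit.BirchSwinnertonDyer.Rank1Residual.ManinAdditive.CuspidalKummerThree

/-! ### §1 The cube of the descended `η`-quotient at level `N` -/

/-- `etaPos` of the third exponent vector `r/3`, cubed, is `etaPos` of `r` (level `N`). [folklore] -/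
theorem etaPos_thirdExp_pow {N : ℕ} {r : ℕ → ℤ} (h3 : ∀ δ ∈ N.divisors, (3 : ℤ) ∣ r δ) :
    etaPos N (thirdExp r) ^ 3 = etaPos N r := by
  rw [etaPos, etaPos, ← Finset.prod_pow]
  refine Finset.prod_congr rfl fun δ hδ => ?_
  rw [← pow_mul, thirdExp_apply, toNat_mul_three_of_dvd (h3 δ hδ)]

/-- `etaNeg` of the third exponent vector `r/3`, cubed, is `etaNeg` of `r` (level `N`). [folklore] -/
theorem etaNeg_thirdExp_pow {N : ℕ} {r : ℕ → ℤ} (h3 : ∀ δ ∈ N.divisors, (3 : ℤ) ∣ r δ) :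
    etaNeg N (thirdExp r) ^ 3 = etaNeg N r := by
  rw [etaNeg, etaNeg, ← Finset.prod_pow]
  refine Finset.prod_congr rfl fun δ hδ => ?_
  rw [← pow_mul, thirdExp_apply, toNat_neg_mul_three_of_dvd (h3 δ hδ)]

/-- `η_{r/3}³ = q^{S₁(r)/24}·g` in `ℂ((q))` (level `N`). -/
theorem etaLaurent_thirdExp_pow {N : ℕ} {r : ℕ → ℤ} {g : ℤ⟦X⟧} (hEta : IsEtaUnitSeries N.divisors r g)
    (h3 : ∀ δ ∈ N.divisors, (3 : ℤ) ∣ r δ) (hs : ModularForms.NewmanCond N (thirdExp r) 0) :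
    etaLaurent N (thirdExp r) ^ 3 =
      HahnSeries.single ((∑ δ ∈ N.divisors, (δ : ℤ) * r δ) / 24) (1 : ℂ) * toLaurent g := by
  have h24 := hs.sum_mul_dvd
  have h3S := three_mul_sum_thirdExp h3 (fun δ => (δ : ℤ))
  set S' := ∑ δ ∈ N.divisors, (δ : ℤ) * thirdExp r δ
  have hexp : (3 : ℤ) * (S' / 24) = (∑ δ ∈ N.divisors, (δ : ℤ) * r δ) / 24 := by
    rw [← h3S]; omega
  rw [etaLaurent, mul_pow, single_pow', div_pow, ← toLaurent_pow, ← toLaurent_pow, etaPos_thirdExp_pow h3,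
    etaNeg_thirdExp_pow h3, ← toLaurent_eq_div_of_isEtaUnitSeries hEta, Nat.cast_ofNat, hexp]

/-! ### §2 N2ᴺ ⟸ M1 ∧ M2 ∧ G0 -/

/-- **PROVED: N2ᴺ `NoNewmanThirdRootRepAtN` ⟸ M1 ∧ M2 ∧ G0** — `u := η_{r/3}·(A/B) ∈ K_N` has `u³ = Θ_T`. -/
theorem noNewmanThirdRootRepAtN_of (hM1 : EtaQuotientMemFunctionField) (hM2 : MonomialNotModularFunction)
    (hG : KummerCubeSeriesNotCubeAtN) : NoNewmanThirdRootRepAtN := by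
  intro W _ _ N _ D a ha h9 hL X₀ Y₀ hT z hz r g A B h3 hs hrep
  obtain ⟨hNew, hEta, hB, hh, n₁, n₂, hG₀, hEq⟩ := hrep
  have he := sub_eq_sum_div_of_rep hM1 hM2 hNew hEta (n₁ := n₁) (n₂ := n₂) hG₀
  have hΘ := laurent_eq_of_rep hB hEq
  set u : LaurentSeries ℂ := etaLaurent N (thirdExp r) * (toLaurent A / toLaurent B) with hu
  have hu_mem : u ∈ ModularForms.modularFunctionField N := mul_mem (hM1 N (thirdExp r) hs) hh
  have hcube : HahnSeries.ofPowerSeries ℤ ℂ ((kummerCubeSeries W D.c X₀ Y₀ z).map (algebraMap ℚ ℂ)) = u ^ 3 := by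
    rw [hΘ, hu, mul_pow, etaLaurent_thirdExp_pow hEta h3 hs, ← he]
  exact hG W D a ha h9 hL X₀ Y₀ hT z hz u hu_mem hcube

end Summit.BirchSwinnertonDyer.BirchSwinnertonDyer.Theorems.ManinLocalTwoThree.CubeRootDescent

/-! ### §3 The closed forms, BY NAME -/

namespace Summit.BirchSwinnertonDyer.BirchSwinnertonDyer.Theorems.ManinLocalTwoThree.CubeRootDescent

open Summit.BirchSwinnertonDyer.Rank1Residual.ManinAdditive.CuspidalKummer
open Summit.BirchSwinnertonDyer.Rank1Residual.ManinAdditive.CuspidalKummerThree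

/-- N2ᴺ ⟸ G0 (M1, M2 are theorems). -/
theorem noNewmanThirdRootRepAtN_of_geometric (hG : KummerCubeSeriesNotCubeAtN) : NoNewmanThirdRootRepAtN :=
  noNewmanThirdRootRepAtN_of etaQuotientMemFunctionField monomialNotModularFunction hG

/-- **LAW₃ ⟸ G1 ∧ G0 (PROVED reduction, BY NAME on the tree's `CuspidalKummerCubeExponentLaw`).** -/
theorem cuspidalKummerCubeExponentLaw_of_levelN (h₂ : CubeRepSecondDescent) (hG : KummerCubeSeriesNotCubeAtN) :
    CuspidalKummerCubeExponentLaw :=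
  cuspidalKummerCubeExponentLaw_of_levelN_descent cubeRepFirstDescent h₂ (noNewmanThirdRootRepAtN_of_geometric hG)

/-- LAW₃♮ (C3 v18 `stub_cubeExponentLawNonBlind`) ⟸ G1 ∧ G0, BY NAME. -/
theorem cuspidalKummerCubeExponentLawNonBlind_of_levelN (h₂ : CubeRepSecondDescent)
    (hG : KummerCubeSeriesNotCubeAtN) : CuspidalKummerCubeExponentLawNonBlind :=
  cuspidalKummerCubeExponentLawNonBlind_of_law (cuspidalKummerCubeExponentLaw_of_levelN h₂ hG)

/-- NB₃ `NoBlindThreeTorsionOptimal` ⟸ E-an-57 ∧ G1 ∧ G0, BY NAME. -/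
theorem noBlindThreeTorsionOptimal_of_levelN (h57 : CuspidalKummerCubeRepresentativeAtNine)
    (h₂ : CubeRepSecondDescent) (hG : KummerCubeSeriesNotCubeAtN) : NoBlindThreeTorsionOptimal :=
  noBlind_of_cuspidalKummerCubeExponentLaw_of_representative (cuspidalKummerCubeExponentLaw_of_levelN h₂ hG) h57

/-- G0 ⟸ P79 (M0 is a theorem): the level-`N` non-cube leaf is implied by the level-`3N` one. -/
theorem kummerCubeSeriesNotCubeAtN_of_atThreeN (hP : KummerCubeSeriesNotCubeAtThreeN) : KummerCubeSeriesNotCubeAtN :=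
  kummerCubeSeriesNotCubeAtN_of_mono_atThreeN modularFunctionFieldMono hP

end Summit.BirchSwinnertonDyer.BirchSwinnertonDyer.Theorems.ManinLocalTwoThree.CubeRootDescent
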